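import Summits.QuantumFields.YangMills.Theorems.F4SubCurvatureDoorPlanarFrames
import Mathlib
import HarnessLib

/-!
# LINE g20-A «angular type» — rung R1 `PlanarAnalyticOffZero` BY NAME (⟨stmt-QuantumFields-23035⟩)

Crux `F4SubCurvatureDoor.ShortRootRigidity` ⟨stmt-QuantumFields-23035⟩, registered skeleton `Cruxes/ShortRootRigidity/Lines/angular_type.lean`,
owner rung file `Cruxes/ShortRootRigidity/Lines/angular_type_rungs.lean` (ns `…AngularTypeRungs`, stamped by idea-crit-4).  This file restates
R1 `PlanarAnalyticOffZero` CHARACTER-IDENTICALLY (`E2`, `InPlanarClass` the registered copies) and PROVES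
`planarAnalyticOffZero : PlanarAnalyticOffZero` — every kernel of the hexagonal planar class is real-analytic off the origin.  It is
also the «restore-first structure» of LINE g19-A §P1 (`Lines/transverse_slice.md`).

PROOF (the 60° geometry is load-bearing).  Fix `k ∈ InPlanarClass` and `y ≠ 0`.  By `…PlanarFrames.exists_good_pair` two of the three
frame normals `n ∈ {e₀, n₊, n₋}` (`n± = (1/2, ±√3/2)`) have frame time `|⟪y, n⟫| ≥ ‖y‖/2`; call them `n₁, n₂` (`|⟪n₁, n₂⟫| = 1/2`,
`det = ±√3/2`).  With `L = ‖y‖/6` consider `P(t) = k(y + L t₁ n₁ + L t₂ n₂)` on the cube `|tᵢ| < 1`: by the transported time holomorphy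
(`…PlanarFrames.frameHolomorphy_zero/_pos/_neg`, i.e. R0 `planarFrameTimeHolomorphy` ✓ moved by the `D₆` rotations) each slice in `t₁`
(resp. `t₂`) is the trace of a function holomorphic on the unit disc — the frame time of the base point is `≥ ‖y‖/2 - L/2 = 5‖y‖/12 > L` — and
all values and axis bounds are values of `|k|` on the compact annulus `‖y‖/4 ≤ ‖·‖ ≤ 2‖y‖`, hence bounded by one `M`.  Siciak's cross theorem
with estimate `Literature.Analysis.Complex.exists_holomorphic_extension_of_separately_local_fintype` (`ι = Fin 2`, `ℓ = 1`) gives ONE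
holomorphic `G` on a polydisc with `G(t) = P(t)` on the real cube, and the chart lemma `…analyticAt_of_holomorphic_chart_fintype` in the
oblique basis `(L n₁, L n₂)` gives `AnalyticAt ℝ k y`.  (For two PERPENDICULAR frames this fails on the axes: `e^{-m|y₀|} e^{-m|y₁|}`.)

HONEST LABEL: R1 is a rung of an OPEN line; nothing about `PlanarConicChart` (the quantitative chart), the stubs (C) `PlanarSpectralCone` /
(A) `AngularContinuation` / `OddModeRigidity`, ⟨23035⟩, ⟨23125⟩, R2d or any summit is proved here; the Yang–Mills mass gap is NOT proved;
no summit is proved by a line.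
-/

noncomputable section

open MeasureTheory Filter Topology Set Metric
open scoped BigOperators

namespace Summit.QuantumFields.YangMills.Theorems.F4SubCurvatureDoorPlanarAnalyticOffZeroRegistered

open Summit.QuantumFields.YangMills.Theorems.F4SubCurvatureDoorSliceDensityRegistered (E2)
open Summit.QuantumFields.YangMills.Theorems.F4SubCurvatureDoorSliceInClassRegistered (InPlanarClass)
open Summit.QuantumFields.YangMills.Theorems.F4SubCurvatureDoorPlanarLaplaceFourier
open Summit.QuantumFields.YangMills.Theorems.F4SubCurvatureDoorPlanarFrameTimeHolomorphyRegistered (mk2)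
open Summit.QuantumFields.YangMills.Theorems.F4SubCurvatureDoorPlanarFrames

/-- **R1 · PlanarAnalyticOffZero** (target, S given R1⁺; budget-free).  Every kernel of the hexagonal planar class is
real-analytic off the origin.  (From R1⁺ by a two-variable chart lemma in the manner of
`Literature.Analysis.Complex.analyticAt_of_holomorphic_chart`.)  Also the «restore-first structure» of LINE g19-A §P1.
[target; sources: JarnickiPflug2011 Ch. 5; OsterwalderSchrader1975] -/
def PlanarAnalyticOffZero : Prop :=
  ∀ k : E2 → ℝ, InPlanarClass k → AnalyticOnNhd ℝ k {y : E2 | y ≠ 0}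

/-! ## The generic two-frame chart -/

/-- Linear independence of two scaled frame vectors with non-zero determinant. -/
theorem linearIndependent_frames {L a₁ b₁ a₂ b₂ : ℝ} (hL : L ≠ 0) (hdet : a₁ * b₂ - a₂ * b₁ ≠ 0)
    (n₁ n₂ : E2) (hn₁0 : n₁ 0 = a₁) (hn₁1 : n₁ 1 = b₁) (hn₂0 : n₂ 0 = a₂) (hn₂1 : n₂ 1 = b₂) :
    LinearIndependent ℝ ![L • n₁, L • n₂] := by
  rw [Fintype.linearIndependent_iff]
  intro g hg
  rw [Fin.sum_univ_two, Matrix.cons_val_zero, Matrix.cons_val_one, Matrix.cons_val_fin_one, smul_smul, smul_smul] at hg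
  have e0 := congrArg (fun z : E2 => z 0) hg
  have e1 := congrArg (fun z : E2 => z 1) hg
  simp only [PiLp.add_apply, PiLp.smul_apply, smul_eq_mul, hn₁0, hn₁1, hn₂0, hn₂1, PiLp.zero_apply] at e0 e1
  have hLdet : L * (a₁ * b₂ - a₂ * b₁) ≠ 0 := mul_ne_zero hL hdet
  have h0 : g 0 * (L * (a₁ * b₂ - a₂ * b₁)) = 0 := by linear_combination b₂ * e0 - a₂ * e1
  have h1 : g 1 * (L * (a₁ * b₂ - a₂ * b₁)) = 0 := by linear_combination a₁ * e1 - b₁ * e0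
  have g0 : g 0 = 0 := (mul_eq_zero.1 h0).resolve_right hLdet
  have g1 : g 1 = 0 := (mul_eq_zero.1 h1).resolve_right hLdet
  intro i
  fin_cases i
  · exact g0
  · exact g1

/-- **Joint analyticity from two good frames.**  Let `k ∈ InPlanarClass`, `y ≠ 0`, and two unit frame normals `(a₁,b₁)`, `(a₂,b₂)` with
`|a₁a₂ + b₁b₂| ≤ 1/2`, `a₁b₂ - a₂b₁ ≠ 0`, frame times `τᵢ(q) = aᵢq₀ + bᵢq₁` satisfying `|τᵢ(y)| ≥ ‖y‖/2`, and complex time translation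
available along both (`hF₁`, `hF₂`, the shape of `…PlanarFrames.frameHolomorphy_*`).  Then `k` is real-analytic at `y`
(`…PlanarFrames.exists_frameChart` + the chart lemma in the oblique basis). -/
theorem analyticAt_of_framePair {k : E2 → ℝ} (hk : InPlanarClass k) {y : E2} (hy : y ≠ 0)
    (τ₁ τ₂ : E2 → ℝ) (a₁ b₁ a₂ b₂ : ℝ) (hn₁ : a₁ ^ 2 + b₁ ^ 2 = 1) (hn₂ : a₂ ^ 2 + b₂ ^ 2 = 1)
    (hτ₁ : ∀ q, τ₁ q = a₁ * q 0 + b₁ * q 1) (hτ₂ : ∀ q, τ₂ q = a₂ * q 0 + b₂ * q 1)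
    (hdet : a₁ * b₂ - a₂ * b₁ ≠ 0) (hinner : |a₁ * a₂ + b₁ * b₂| ≤ 1 / 2)
    (hy₁ : ‖y‖ / 2 ≤ |τ₁ y|) (hy₂ : ‖y‖ / 2 ≤ |τ₂ y|)
    (hF₁ : ∀ q : E2, τ₁ q ≠ 0 → ∃ g : ℂ → ℂ, DifferentiableOn ℂ g (ball (0 : ℂ) |τ₁ q|) ∧
        (∀ u : ℝ, |u| < |τ₁ q| → g u = k (mk2 (q 0 + u * a₁) (q 1 + u * b₁))) ∧
        ∀ w ∈ ball (0 : ℂ) |τ₁ q|, ‖g w‖ ≤ k (mk2 (τ₁ q + w.re) 0))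
    (hF₂ : ∀ q : E2, τ₂ q ≠ 0 → ∃ g : ℂ → ℂ, DifferentiableOn ℂ g (ball (0 : ℂ) |τ₂ q|) ∧
        (∀ u : ℝ, |u| < |τ₂ q| → g u = k (mk2 (q 0 + u * a₂) (q 1 + u * b₂))) ∧
        ∀ w ∈ ball (0 : ℂ) |τ₂ q|, ‖g w‖ ≤ k (mk2 (τ₂ q + w.re) 0)) :
    AnalyticAt ℝ k y := by
  obtain ⟨r, hr, hcross⟩ :=
    Literature.Analysis.Complex.exists_holomorphic_extension_of_separately_local_fintype (ι := Fin 2) 1 one_pos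
  obtain ⟨z₀, -, G, hGd, -, hGr⟩ := exists_frameChart hk hy τ₁ τ₂ a₁ b₁ a₂ b₂ hn₁ hn₂ hτ₁ hτ₂ hinner hy₁ hy₂ hF₁ hF₂ hcross
  -- the oblique basis and the chart lemma
  have hy_pos : 0 < ‖y‖ := norm_pos_iff.2 hy
  have hL : (‖y‖ / 6) ≠ 0 := by positivity
  have hli : LinearIndependent ℝ (![(‖y‖ / 6) • mk2 a₁ b₁, (‖y‖ / 6) • mk2 a₂ b₂] : Fin 2 → E2) :=
    linearIndependent_frames hL hdet (mk2 a₁ b₁) (mk2 a₂ b₂) (mk2_zero _ _) (mk2_one _ _) (mk2_zero _ _) (mk2_one _ _)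
  obtain ⟨bs, hbs⟩ : ∃ bs : Module.Basis (Fin 2) ℝ E2, ∀ j, bs j = (![(‖y‖ / 6) • mk2 a₁ b₁, (‖y‖ / 6) • mk2 a₂ b₂] : Fin 2 → E2) j :=
    ⟨basisOfLinearIndependentOfCardEqFinrank hli (by simp), fun j => by
      rw [coe_basisOfLinearIndependentOfCardEqFinrank]⟩
  refine Literature.Analysis.Complex.analyticAt_of_holomorphic_chart_fintype bs hr hGd fun t ht => ?_
  rw [hGr t ht, Fin.sum_univ_two, hbs, hbs, Matrix.cons_val_zero, Matrix.cons_val_one, Matrix.cons_val_fin_one,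
    smul_smul, smul_smul, ← add_assoc]

/-! ## The rung -/

/-- **RUNG R1 (by name): `PlanarAnalyticOffZero`.** -/
theorem planarAnalyticOffZero : PlanarAnalyticOffZero := by
  intro k hk y hy
  have h3 : Real.sqrt 3 ^ 2 = 3 := sqrt3_sq
  -- frame data
  have hnE : (1 : ℝ) ^ 2 + (0 : ℝ) ^ 2 = 1 := by norm_num
  have hnP : (1 / 2 : ℝ) ^ 2 + (Real.sqrt 3 / 2) ^ 2 = 1 := by nlinarith
  have hnM : (1 / 2 : ℝ) ^ 2 + (-(Real.sqrt 3 / 2)) ^ 2 = 1 := by nlinarith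
  have hτE : ∀ q : E2, q 0 = 1 * q 0 + 0 * q 1 := fun q => by ring
  have hτP : ∀ q : E2, q 0 / 2 + Real.sqrt 3 / 2 * q 1 = 1 / 2 * q 0 + Real.sqrt 3 / 2 * q 1 := fun q => by ring
  have hτM : ∀ q : E2, q 0 / 2 - Real.sqrt 3 / 2 * q 1 = 1 / 2 * q 0 + -(Real.sqrt 3 / 2) * q 1 := fun q => by ring
  have hs3 : 0 < Real.sqrt 3 := Real.sqrt_pos.2 (by norm_num)
  rcases exists_good_pair y with ⟨h1, h2⟩ | ⟨h1, h2⟩ | ⟨h1, h2⟩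
  · exact analyticAt_of_framePair hk hy (fun q => q 0) (fun q => q 0 / 2 + Real.sqrt 3 / 2 * q 1) 1 0 (1 / 2) (Real.sqrt 3 / 2)
      hnE hnP hτE hτP (by nlinarith) (by norm_num) h1 h2 (frameHolomorphy_zero hk) (frameHolomorphy_pos hk)
  · exact analyticAt_of_framePair hk hy (fun q => q 0) (fun q => q 0 / 2 - Real.sqrt 3 / 2 * q 1) 1 0 (1 / 2) (-(Real.sqrt 3 / 2))
      hnE hnM hτE hτM (by nlinarith) (by norm_num) h1 h2 (frameHolomorphy_zero hk) (frameHolomorphy_neg hk)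
  · exact analyticAt_of_framePair hk hy (fun q => q 0 / 2 + Real.sqrt 3 / 2 * q 1) (fun q => q 0 / 2 - Real.sqrt 3 / 2 * q 1)
      (1 / 2) (Real.sqrt 3 / 2) (1 / 2) (-(Real.sqrt 3 / 2)) hnP hnM hτP hτM (by nlinarith)
      (by rw [show (1 / 2 : ℝ) * (1 / 2) + Real.sqrt 3 / 2 * -(Real.sqrt 3 / 2) = -(1 / 2) by nlinarith]; norm_num) h1 h2
      (frameHolomorphy_pos hk) (frameHolomorphy_neg hk)

end Summit.QuantumFields.YangMills.Theorems.F4SubCurvatureDoorPlanarAnalyticOffZeroRegistered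

end
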